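import Summits.HodgeConjecture.CorCM.MultiFieldWeilBlockGluing
import HarnessLib

/-!
# MULTI-FIELD WEIL ENGINE — ANY NUMBER OF PAIRWISE FOREIGN BLOCKS: the Hodge conjecture glues block by block

Cell `pub-hodgecm2` (COR-CM), seat b30 gen 31 (2026-08-24); count-neutral own lane MULTI-FIELD WEIL ENGINE (stem `MultiFieldWeil*`); the inductive form of
`CorCM/MultiFieldWeilBlockGluing.lean` (G8).  Theorems only; no definition, no named fact, no `sorry`; UNCONDITIONAL (a pure transfer statement).  `HC_CM` is NOT
proved and not asserted.

THE STATEMENT (**`hodgeConjectureFor_prod_of_foreign_blocks`**).  Realisations `A_i ⊨ (K_i; Φ_i)` (`i ∈ I`, a nonempty family), a block map `b : I → β`, and for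
every block `c` an automorphism `σ_c ∈ Aut(ℂ)` which is complex conjugation on every complex embedding of every `K_i` with `b i = c` and the identity on every
embedding of every other `K_i`.  If the Hodge conjecture holds for every product of copies of the members of each single block, then it holds for EVERY product of
copies `⨁_j A_{π j}` of the whole family.  PROOF: induction on a finite set `S` of blocks containing the blocks of the factors, peeling one block off with G8
`hodgeConjectureFor_prod_of_blocks` applied to the sub-family indexed by `{i // b i ∈ insert c S}`.  The automorphisms `σ_c` exist, e.g., when the compositum of
the Galois closures of block `c` meets the compositum of ALL the other closures in a totally real field
(`PartialConjugation.exists_ringEquiv_conj_fix_of_conj_apply_eq`, as in G8's `…_of_conj_apply_eq`).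

[cite: Pohlmann1968, Thm 1] [cite: Milne2020HodgeClassesAV, 1.2 (a) and Thm. 1] [cite: Gordon1999HodgeAVSurvey, §3 Theorem (proof), 7.5–7.7]

## References
* [Pohlmann1968] H. Pohlmann, Ann. of Math. 88 (1968), Thm 1.  [Milne2020HodgeClassesAV] J. S. Milne, *Hodge classes on abelian varieties* (notes, 2020), §1.
  [Gordon1999HodgeAVSurvey] B. B. Gordon, *A survey of the Hodge conjecture for abelian varieties*, §3, 7.5–7.7.
-/

noncomputable section

open CategoryTheory CategoryTheory.Limits NumberField IntermediateField

namespace Summit.HodgeConjecture.CorCM.MultiFieldWeil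

open Literature.AlgebraicGeometry Literature.AlgebraicGeometry.Motives Literature.AlgebraicGeometry.HodgeTheory
open Literature.AlgebraicGeometry.ComplexMultiplication (IsCMTypeRealisation)
open Literature.AlgebraicTopology.SingularHomology
open Literature.NumberTheory.ComplexMultiplication

open scoped Classical

section Foreign

variable {I : Type} {K : I → Type} [∀ i, Field (K i)] [∀ i, NumberField (K i)] [∀ i, IsCMField (K i)]
  {Φ : ∀ i, CMType (K i)} {A : I → AbelianVariety ℂ} {ι : ∀ i, 𝓞 (K i) →+* End (A i)} {θ : ∀ i, K i →+* Module.End ℂ (complexBetti (A i).X 1)}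
  {β : Type}

/-- **Induction engine.**  For every finite set `S` of blocks: the Hodge conjecture holds for every product of copies of members of the blocks in `S` — by induction on
`S`, peeling one block `c` off with G8 `hodgeConjectureFor_prod_of_blocks` on the sub-family `{i // b i ∈ insert c S}` (block `c` against the rest).
[cite: Pohlmann1968, Thm 1] [cite: Milne2020HodgeClassesAV, Thm. 1] -/
theorem hodgeConjectureFor_prod_of_foreign_blocks_finset (hA : ∀ i, IsCMTypeRealisation (Φ i) (A i) (ι i) (θ i)) (b : I → β)
    (hσ : ∀ c : β, ∃ σ : ℂ ≃+* ℂ, (∀ i, b i = c → ∀ x : K i →+* ℂ, (σ : ℂ →+* ℂ).comp x = ComplexEmbedding.conjugate x) ∧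
      (∀ i, b i ≠ c → ∀ x : K i →+* ℂ, (σ : ℂ →+* ℂ).comp x = x))
    (hblk : ∀ (c : β) (M : ℕ) (ρ : Fin M → I), (∀ l, b (ρ l) = c) → HodgeConjectureFor (⨁ fun l => A (ρ l)).dim (⨁ fun l => A (ρ l)).X)
    (c₀ : β) (S : Finset β) :
    ∀ (M : ℕ) (ρ : Fin M → I), (∀ l, b (ρ l) ∈ S) → HodgeConjectureFor (⨁ fun l => A (ρ l)).dim (⨁ fun l => A (ρ l)).X := by
  induction S using Finset.induction_on with
  | empty =>
    intro M ρ hρ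
    cases M with
    | zero => exact hblk c₀ 0 ρ fun l => l.elim0
    | succ M => exact absurd (hρ 0) (Finset.notMem_empty _)
  | insert c S hcS ih =>
    intro M ρ hρ
    obtain ⟨σ, hσB, hσC⟩ := hσ c
    -- the sub-family indexed by the blocks in `insert c S`
    let T : Finset β := insert c S
    let I' : Type := {i : I // b i ∈ T}
    have hA' : ∀ i' : I', IsCMTypeRealisation (Φ i'.1) (A i'.1) (ι i'.1) (θ i'.1) := fun i' => hA i'.1
    have key := hodgeConjectureFor_prod_of_blocks (K := fun i' : I' => K i'.1) (A := fun i' : I' => A i'.1) hA' (fun i' => b i'.1 = c) σ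
      (fun i' hi' => hσB i'.1 hi') (fun i' hi' => hσC i'.1 hi') (fun M' ρ' hρ' => hblk c M' (fun l => (ρ' l).1) hρ')
      (fun M' ρ' hρ' => ih M' (fun l => (ρ' l).1) fun l => by
        have hmem : b (ρ' l).1 ∈ T := (ρ' l).2
        rcases Finset.mem_insert.1 hmem with h | h
        · exact absurd h (hρ' l)
        · exact h)
      (fun l => (⟨ρ l, hρ l⟩ : I'))
    exact key

/-- **THE HODGE CONJECTURE GLUES ALONG ANY NUMBER OF PAIRWISE FOREIGN BLOCKS.**  Realisations `A_i ⊨ (K_i; Φ_i)` of a nonempty family, a block map `b : I → β`, for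
every block `c` an automorphism of `ℂ` acting as complex conjugation on the complex embeddings of the fields of block `c` and trivially on those of all other blocks,
and the Hodge conjecture for every product of copies inside each block ⟹ the Hodge conjecture for EVERY product of copies `⨁_j A_{π j}` of the whole family.  No
named fact. [cite: Pohlmann1968, Thm 1] [cite: Milne2020HodgeClassesAV, 1.2 (a) and Thm. 1] [cite: Gordon1999HodgeAVSurvey, §3 Theorem (proof), 7.5–7.7] -/
theorem hodgeConjectureFor_prod_of_foreign_blocks [Nonempty I] (hA : ∀ i, IsCMTypeRealisation (Φ i) (A i) (ι i) (θ i)) (b : I → β)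
    (hσ : ∀ c : β, ∃ σ : ℂ ≃+* ℂ, (∀ i, b i = c → ∀ x : K i →+* ℂ, (σ : ℂ →+* ℂ).comp x = ComplexEmbedding.conjugate x) ∧
      (∀ i, b i ≠ c → ∀ x : K i →+* ℂ, (σ : ℂ →+* ℂ).comp x = x))
    (hblk : ∀ (c : β) (M : ℕ) (ρ : Fin M → I), (∀ l, b (ρ l) = c) → HodgeConjectureFor (⨁ fun l => A (ρ l)).dim (⨁ fun l => A (ρ l)).X)
    {N : ℕ} (π : Fin N → I) : HodgeConjectureFor (⨁ fun j => A (π j)).dim (⨁ fun j => A (π j)).X :=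
  hodgeConjectureFor_prod_of_foreign_blocks_finset hA b hσ hblk (b (Classical.arbitrary I)) (Finset.univ.image fun j => b (π j)) N π fun j =>
    Finset.mem_image_of_mem _ (Finset.mem_univ j)

/-- **From number-field data.**  If for every block `c` complex conjugation fixes the intersection of `L_c = ⨆_{b i = c} L(K_i)` with `L_c' = ⨆_{b i ≠ c} L(K_i)`
(`L(K) = normalClosure ℚ K ℂ`; e.g. the two composita meet in `ℚ`, or in a field of odd degree), the automorphisms `σ_c` exist (the tree's gluing lemma
`exists_ringEquiv_apply_eq_of_normal`) and the Hodge conjecture glues from the blocks. [cite: Lang2002, VI §1 Thm. 1.14 and V §2 Thm. 2.8] [cite: Pohlmann1968, Thm 1] -/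
theorem hodgeConjectureFor_prod_of_foreign_blocks_of_conj_apply_eq [Finite I] [Nonempty I] (hA : ∀ i, IsCMTypeRealisation (Φ i) (A i) (ι i) (θ i)) (b : I → β)
    (hreal : ∀ (c : β) (x : ℂ), x ∈ (⨆ i : {i : I // b i = c}, normalClosure ℚ (K i.1) ℂ) → x ∈ (⨆ i : {i : I // b i ≠ c}, normalClosure ℚ (K i.1) ℂ) →
      starRingEnd ℂ x = x)
    (hblk : ∀ (c : β) (M : ℕ) (ρ : Fin M → I), (∀ l, b (ρ l) = c) → HodgeConjectureFor (⨁ fun l => A (ρ l)).dim (⨁ fun l => A (ρ l)).X)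
    {N : ℕ} (π : Fin N → I) : HodgeConjectureFor (⨁ fun j => A (π j)).dim (⨁ fun j => A (π j)).X := by
  haveI : ∀ j : I, @Normal ℚ ↥(normalClosure ℚ (K j) ℂ) _ _ (IntermediateField.algebra' _) := normal_normalClosure_complex
  refine hodgeConjectureFor_prod_of_foreign_blocks hA b (fun c => ?_) hblk π
  haveI : Finite {i : I // b i = c} := Subtype.finite
  haveI : Finite {i : I // b i ≠ c} := Subtype.finite
  obtain ⟨σ, hσA, hσB'⟩ := exists_ringEquiv_apply_eq_of_normal (A := ⨆ i : {i : I // b i = c}, normalClosure ℚ (K i.1) ℂ)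
    (B := ⨆ i : {i : I // b i ≠ c}, normalClosure ℚ (K i.1) ℂ) (starRingAut : ℂ ≃+* ℂ)
    (fun x h₁ h₂ => by rw [starRingAut_apply, ← starRingEnd_apply]; exact hreal c x h₁ h₂)
  refine ⟨σ, fun i hi x => RingHom.ext fun y => ?_, fun i hi x => RingHom.ext fun y => ?_⟩
  · have hy : x y ∈ (⨆ i : {i : I // b i = c}, normalClosure ℚ (K i.1) ℂ) :=
      (le_iSup (fun i : {i : I // b i = c} => normalClosure ℚ (K i.1) ℂ) ⟨i, hi⟩ : normalClosure ℚ (K i) ℂ ≤ _) (apply_mem_normalClosure i x y)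
    rw [RingHom.coe_comp, Function.comp_apply, RingHom.coe_coe, hσA _ hy]
    rfl
  · have hy : x y ∈ (⨆ i : {i : I // b i ≠ c}, normalClosure ℚ (K i.1) ℂ) :=
      (le_iSup (fun i : {i : I // b i ≠ c} => normalClosure ℚ (K i.1) ℂ) ⟨i, hi⟩ : normalClosure ℚ (K i) ℂ ≤ _) (apply_mem_normalClosure i x y)
    rw [RingHom.coe_comp, Function.comp_apply, RingHom.coe_coe, hσB' _ hy]

/-- **In particular: each block's closure-compositum meets the others' in `ℚ`** (pairwise — indeed jointly — linearly disjoint blocks). [cite: Lang2002, VI §1 Thm. 1.14] -/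
theorem hodgeConjectureFor_prod_of_foreign_blocks_of_inf_eq_bot [Finite I] [Nonempty I] (hA : ∀ i, IsCMTypeRealisation (Φ i) (A i) (ι i) (θ i)) (b : I → β)
    (hinf : ∀ c : β, (⨆ i : {i : I // b i = c}, normalClosure ℚ (K i.1) ℂ) ⊓ (⨆ i : {i : I // b i ≠ c}, normalClosure ℚ (K i.1) ℂ) = ⊥)
    (hblk : ∀ (c : β) (M : ℕ) (ρ : Fin M → I), (∀ l, b (ρ l) = c) → HodgeConjectureFor (⨁ fun l => A (ρ l)).dim (⨁ fun l => A (ρ l)).X)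
    {N : ℕ} (π : Fin N → I) : HodgeConjectureFor (⨁ fun j => A (π j)).dim (⨁ fun j => A (π j)).X := by
  refine hodgeConjectureFor_prod_of_foreign_blocks_of_conj_apply_eq hA b (fun c x h₁ h₂ => ?_) hblk π
  have hx : x ∈ (⊥ : IntermediateField ℚ ℂ) := by
    rw [← hinf c]
    exact ⟨h₁, h₂⟩
  rw [IntermediateField.mem_bot] at hx
  obtain ⟨q, rfl⟩ := hx
  rw [eq_ratCast]
  exact map_ratCast (starRingEnd ℂ) q

/-- **In particular: each block's closure-compositum meets the others' in a field of ODD degree** (a normal subfield of `ℂ` of odd degree is totally real, so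
complex conjugation fixes the intersection). [cite: Lang2002, VI §1 Thm. 1.14] [cite: Pohlmann1968, Thm 1] -/
theorem hodgeConjectureFor_prod_of_foreign_blocks_of_odd_finrank_inf [Finite I] [Nonempty I] (hA : ∀ i, IsCMTypeRealisation (Φ i) (A i) (ι i) (θ i)) (b : I → β)
    (hodd : ∀ c : β, Odd (Module.finrank ℚ
      ↥((⨆ i : {i : I // b i = c}, normalClosure ℚ (K i.1) ℂ) ⊓ (⨆ i : {i : I // b i ≠ c}, normalClosure ℚ (K i.1) ℂ))))
    (hblk : ∀ (c : β) (M : ℕ) (ρ : Fin M → I), (∀ l, b (ρ l) = c) → HodgeConjectureFor (⨁ fun l => A (ρ l)).dim (⨁ fun l => A (ρ l)).X)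
    {N : ℕ} (π : Fin N → I) : HodgeConjectureFor (⨁ fun j => A (π j)).dim (⨁ fun j => A (π j)).X := by
  haveI : ∀ j : I, @Normal ℚ ↥(normalClosure ℚ (K j) ℂ) _ _ (IntermediateField.algebra' _) := normal_normalClosure_complex
  refine hodgeConjectureFor_prod_of_foreign_blocks_of_conj_apply_eq hA b (fun c x h₁ h₂ => ?_) hblk π
  haveI : Finite {i : I // b i = c} := Subtype.finite
  haveI : Finite {i : I // b i ≠ c} := Subtype.finite
  haveI hfd : FiniteDimensional ℚ ↥(⨆ i : {i : I // b i = c}, normalClosure ℚ (K i.1) ℂ) := inferInstance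
  haveI : FiniteDimensional ℚ ↥((⨆ i : {i : I // b i = c}, normalClosure ℚ (K i.1) ℂ) ⊓ (⨆ i : {i : I // b i ≠ c}, normalClosure ℚ (K i.1) ℂ)) :=
    FiniteDimensional.of_injective
      (IntermediateField.inclusion (inf_le_left : (⨆ i : {i : I // b i = c}, normalClosure ℚ (K i.1) ℂ) ⊓
        (⨆ i : {i : I // b i ≠ c}, normalClosure ℚ (K i.1) ℂ) ≤ _)).toLinearMap
      (IntermediateField.inclusion_injective (inf_le_left : (⨆ i : {i : I // b i = c}, normalClosure ℚ (K i.1) ℂ) ⊓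
        (⨆ i : {i : I // b i ≠ c}, normalClosure ℚ (K i.1) ℂ) ≤ _))
  exact conj_apply_eq_of_odd_finrank _ (hodd c) ⟨h₁, h₂⟩

end Foreign

end Summit.HodgeConjecture.CorCM.MultiFieldWeil
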